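import Literature.Probability.RandomPlanarGeometry.WholePlaneSLE
import Mathlib.MeasureTheory.Integral.DominatedConvergence
import HarnessLib

/-!
# The stationary SLE_κ(ρ) angle law: the increment functional, and reduction to `ρ = 0` by time scaling

Topic `Probability/RandomPlanarGeometry`; sequel of `WholePlaneSLE`, first step of the proof of
the named fact `IsStationaryAngleLaw.exists_unique` (Miller–Sheffield (2017), Prop. 2.1: existence
and uniqueness of the stationary solution of the SLE_κ(ρ) angle equation
`dθ = ((ρ+2)/2) cot(θ/2) dt + √κ dB`, their (2.5), in the non-hitting regime `κ ≤ 2(ρ+2)`).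

* **API of the martingale-problem increment** `angleIncrement κ ρ f s t` for a `C²` test function
  `f` compactly supported in `(0, 2π)`: the generator `L f = (κ/2) f'' + ((ρ+2)/2) cot(·/2) f'`
  applied to `f` is continuous and compactly supported (`continuous_angleGenerator`,
  `exists_bound_angleGenerator`), the increment is a bounded continuous (hence measurable and, under
  every finite measure, integrable) function of the path (`continuous_angleIncrement`,
  `abs_angleIncrement_le`, `integrable_angleIncrement`); and the conditional-expectation clause
  `P[N | ℱₛ] = 0` is equivalent to the vanishing of `∫_A N dP` over `A ∈ ℱₛ`
  (`condExp_ae_eq_zero_iff_forall_setIntegral_eq_zero`).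
* **Time scaling.** For `c > 0` the map `timeScale c : x ↦ x(c ·)` of `C(ℝ, ℝ)` transports
  stationary angle laws: `IsStationaryAngleLaw κ ρ P → IsStationaryAngleLaw (cκ) (c(ρ+2) - 2) (P ∘ (timeScale c)⁻¹)`
  (`IsStationaryAngleLaw.map_timeScale`; the generator scales as `L_{cκ, c(ρ+2)-2} = c L_{κ,ρ}`,
  `angleGenerator_scale`, and `∫ₛᵗ c (Lf)(x(cu)) du = ∫_{cs}^{ct} (Lf)(x(v)) dv`), with inverse
  `timeScale c⁻¹`. Choosing `c = 2/(ρ+2)` kills the force-point weight: **the general fact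
  `IsStationaryAngleLaw.exists_unique` follows from its case `ρ = 0`, `0 < κ ≤ 4`**
  (`IsStationaryAngleLaw.exists_unique_of_rho_zero`), i.e. from existence and uniqueness of the
  stationary law of the radial Bessel process `dY = cot(Y/2) dt + √κ dB` of the tree
  (`RadialBesselFlow` and sequels; Lawler (2005), (1.16)). This is the time change
  `t ↦ ((ρ+2)/2) t` implicit in Miller–Sheffield (2017), §2.1.2 (Bessel dimension
  `d(ρ, κ) = 1 + 2(ρ+2)/κ` depends on `(κ, ρ)` only through `κ/(ρ+2)`).

## References

* J. Miller, S. Sheffield, *Imaginary geometry IV: interior rays, whole-plane reversibility, and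
  space-filling trees*, Probab. Theory Related Fields 169 (2017), arXiv:1302.4738: §2.1.2,
  eq. (2.5), Prop. 2.1. [MillerSheffield2013]
* I. Karatzas, S. Shreve, *Brownian Motion and Stochastic Calculus* (1988), Ch. 5 §4.B
  (martingale problem). [KaratzasShreve1988]
* G. F. Lawler, *Conformally Invariant Processes in the Plane*, AMS (2005), §1.11 eq. (1.16).
  [Lawler2005]
-/

noncomputable section

open Set Filter Topology MeasureTheory ProbabilityTheory
open scoped NNReal Real ENNReal

namespace Literature.Probability.RandomPlanarGeometry

open scoped PathBorel

/-! ### The conditional-expectation clause as vanishing of set integrals -/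

/-- For an integrable `g` on a finite measure space and a sub-σ-algebra `m`, **`P[g | m] = 0` a.e.
iff `∫_A g dP = 0` for every `m`-measurable `A`** (uniqueness of the conditional expectation).
[folklore] -/
theorem condExp_ae_eq_zero_iff_forall_setIntegral_eq_zero {Ω : Type*} {m m0 : MeasurableSpace Ω}
    {P : Measure Ω} [IsFiniteMeasure P] (hm : m ≤ m0) {g : Ω → ℝ} (hg : Integrable g P) :
    P[g | m] =ᵐ[P] 0 ↔ ∀ s, MeasurableSet[m] s → ∫ x in s, g x ∂P = 0 := by
  constructor
  · intro h s hs
    rw [← setIntegral_condExp hm hg hs, setIntegral_congr_ae (hm s hs) (h.mono fun x hx _ ↦ hx)]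
    simp
  · intro h
    have h0 := ae_eq_condExp_of_forall_setIntegral_eq hm hg (g := fun _ ↦ (0 : ℝ))
      (fun s _ _ ↦ integrableOn_zero) (fun s hs _ ↦ by rw [h s hs]; simp)
      aestronglyMeasurable_zero
    exact h0.symm

/-! ### The generator on compactly supported test functions -/

section Generator

variable {κ : ℝ≥0} {ρ : ℝ} {f : ℝ → ℝ}

/-- `cot` is continuous at every point where `sin ≠ 0`. [folklore] -/
theorem continuousAt_cot {y : ℝ} (hy : Real.sin y ≠ 0) : ContinuousAt Real.cot y := by
  have hfun : Real.cot = fun z ↦ Real.cos z / Real.sin z := funext Real.cot_eq_cos_div_sin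
  rw [hfun]
  exact Real.continuous_cos.continuousAt.div Real.continuous_sin.continuousAt hy

/-- Off the topological support of `f`, the derivative of `f` vanishes near the point. [folklore] -/
theorem deriv_eventuallyEq_zero_of_notMem_tsupport {y : ℝ} (hy : y ∉ tsupport f) :
    deriv f =ᶠ[𝓝 y] fun _ ↦ 0 := by
  have h0 : f =ᶠ[𝓝 y] fun _ ↦ 0 := notMem_tsupport_iff_eventuallyEq.1 hy
  -- `f = 0` on an open neighbourhood, so `deriv f = 0` there
  obtain ⟨u, hu, huo, hyu⟩ := eventually_nhds_iff.1 h0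
  filter_upwards [huo.mem_nhds hyu] with z hz
  have hz0 : f =ᶠ[𝓝 z] fun _ ↦ 0 := eventually_nhds_iff.2 ⟨u, hu, huo, hz⟩
  rw [hz0.deriv_eq, deriv_const]

/-- Off the topological support of `f`, the second derivative vanishes. [folklore] -/
theorem iteratedDeriv_two_eq_zero_of_notMem_tsupport {y : ℝ} (hy : y ∉ tsupport f) :
    iteratedDeriv 2 f y = 0 := by
  rw [iteratedDeriv_succ, iteratedDeriv_one, (deriv_eventuallyEq_zero_of_notMem_tsupport hy).deriv_eq,
    deriv_const]

/-- **Off the support of `f` the generator vanishes**: `L f (y) = 0` for `y ∉ tsupport f`.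
[folklore] -/
theorem angleGenerator_eq_zero_of_notMem_tsupport {y : ℝ} (hy : y ∉ tsupport f) :
    angleGenerator κ ρ f y = 0 := by
  rw [angleGenerator, iteratedDeriv_two_eq_zero_of_notMem_tsupport hy,
    (deriv_eventuallyEq_zero_of_notMem_tsupport hy).eq_of_nhds]
  simp

/-- **`L f` is continuous** for `f ∈ C²` with `tsupport f ⊆ (0, 2π)`: on `(0, 2π)` it is a sum of
products of continuous functions (`sin(y/2) ≠ 0`), and off `tsupport f` it vanishes near every
point. [folklore] -/
theorem continuous_angleGenerator (hf : ContDiff ℝ 2 f) (hsupp : tsupport f ⊆ Ioo 0 (2 * π)) :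
    Continuous (angleGenerator κ ρ f) := by
  have h2 : Continuous (iteratedDeriv 2 f) := hf.continuous_iteratedDeriv 2 (by norm_num)
  have h1 : Continuous (deriv f) := hf.continuous_deriv (by norm_num)
  refine continuous_iff_continuousAt.2 fun y ↦ ?_
  by_cases hy : y ∈ tsupport f
  · have hyI := hsupp hy
    have hsin : Real.sin (y / 2) ≠ 0 :=
      (Real.sin_pos_of_pos_of_lt_pi (by linarith [hyI.1]) (by linarith [hyI.2])).ne'
    have hhalf : Continuous fun z : ℝ ↦ z / 2 := continuous_id.div_const (2 : ℝ)
    have hcot : ContinuousAt (fun y : ℝ ↦ Real.cot (y / 2)) y :=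
      ContinuousAt.comp (f := fun z : ℝ ↦ z / 2) (x := y) (continuousAt_cot hsin) hhalf.continuousAt
    exact ((continuous_const.continuousAt.mul h2.continuousAt)).add
      ((continuous_const.continuousAt.mul hcot).mul h1.continuousAt)
  · -- near `y` the generator vanishes identically
    have hev : angleGenerator κ ρ f =ᶠ[𝓝 y] fun _ ↦ 0 := by
      have hopen : IsOpen (tsupport f)ᶜ := (isClosed_tsupport f).isOpen_compl
      filter_upwards [hopen.mem_nhds hy] with z hz
      exact angleGenerator_eq_zero_of_notMem_tsupport hz
    exact (continuousAt_const.congr_of_eventuallyEq hev :)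

/-- **`L f` is bounded**: `|L f| ≤ C` for `f ∈ C²` compactly supported in `(0, 2π)`. [folklore] -/
theorem exists_bound_angleGenerator (hf : ContDiff ℝ 2 f) (hc : HasCompactSupport f)
    (hsupp : tsupport f ⊆ Ioo 0 (2 * π)) : ∃ C, 0 ≤ C ∧ ∀ y, |angleGenerator κ ρ f y| ≤ C := by
  obtain ⟨C, hC⟩ := hc.isCompact.exists_bound_of_continuousOn
    (continuous_angleGenerator hf hsupp).continuousOn
  refine ⟨max C 0, le_max_right _ _, fun y ↦ ?_⟩
  by_cases hy : y ∈ tsupport f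
  · exact (le_max_left _ _).trans' (by simpa [Real.norm_eq_abs] using hC y hy)
  · rw [angleGenerator_eq_zero_of_notMem_tsupport hy, abs_zero]; exact le_max_right _ _

/-- **`f` is bounded** (continuous with compact support). [folklore] -/
theorem exists_bound_of_hasCompactSupport (hf : Continuous f) (hc : HasCompactSupport f) :
    ∃ C, 0 ≤ C ∧ ∀ y, |f y| ≤ C := by
  obtain ⟨C, hC⟩ := hc.exists_bound_of_continuous hf
  exact ⟨max C 0, le_max_right _ _, fun y ↦
    (le_max_left _ _).trans' (by simpa [Real.norm_eq_abs] using hC y)⟩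

/-- **The generator scales linearly under `(κ, ρ + 2) ↦ (cκ, c(ρ + 2))`**:
`L_{cκ, c(ρ+2)-2} f = c · L_{κ,ρ} f`. [folklore] -/
theorem angleGenerator_scale (κ : ℝ≥0) (ρ : ℝ) (c : ℝ≥0) (f : ℝ → ℝ) (y : ℝ) :
    angleGenerator (c * κ) (c * (ρ + 2) - 2) f y = c * angleGenerator κ ρ f y := by
  simp only [angleGenerator, NNReal.coe_mul]
  ring

end Generator

/-! ### The increment functional is bounded and continuous on path space -/

section Increment

variable {κ : ℝ≥0} {ρ : ℝ} {f : ℝ → ℝ}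

/-- The evaluation `(x, u) ↦ x u` on `C(ℝ, ℝ) × ℝ` composed with a continuous `G` is jointly
continuous. [folklore] -/
theorem continuous_comp_eval {G : ℝ → ℝ} (hG : Continuous G) :
    Continuous fun p : C(ℝ, ℝ) × ℝ ↦ G (p.1 p.2) :=
  hG.comp continuous_eval

/-- **The increment `N^f_{s,t}(x) = f(x t) - f(x s) - ∫ₛᵗ (Lf)(x u) du` is a continuous function of
the path** (compact-open topology), for `f ∈ C²` with `tsupport f ⊆ (0, 2π)`. [folklore] -/
theorem continuous_angleIncrement (hf : ContDiff ℝ 2 f) (hsupp : tsupport f ⊆ Ioo 0 (2 * π))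
    (s t : ℝ) : Continuous (angleIncrement κ ρ f s t) := by
  have hfc : Continuous f := hf.continuous
  have hG := continuous_angleGenerator (κ := κ) (ρ := ρ) hf hsupp
  have hint : Continuous fun x : C(ℝ, ℝ) ↦ ∫ u in s..t, angleGenerator κ ρ f (x u) :=
    intervalIntegral.continuous_parametric_intervalIntegral_of_continuous'
      (f := fun (x : C(ℝ, ℝ)) (u : ℝ) ↦ angleGenerator κ ρ f (x u)) (continuous_comp_eval hG) s t
  unfold angleIncrement
  exact ((hfc.comp (continuous_eval_const t)).sub (hfc.comp (continuous_eval_const s))).sub hint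

/-- The increment functional is Borel measurable on `C(ℝ, ℝ)`. [folklore] -/
theorem measurable_angleIncrement (hf : ContDiff ℝ 2 f) (hsupp : tsupport f ⊆ Ioo 0 (2 * π))
    (s t : ℝ) : Measurable (angleIncrement κ ρ f s t) :=
  (continuous_angleIncrement hf hsupp s t).measurable

/-- **The increment functional is bounded**: `|N^f_{s,t}| ≤ 2 sup|f| + |t - s| sup|Lf|`.
[folklore] -/
theorem exists_bound_angleIncrement (hf : ContDiff ℝ 2 f) (hc : HasCompactSupport f)
    (hsupp : tsupport f ⊆ Ioo 0 (2 * π)) (s t : ℝ) :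
    ∃ C, 0 ≤ C ∧ ∀ x, |angleIncrement κ ρ f s t x| ≤ C := by
  obtain ⟨Cf, hCf0, hCf⟩ := exists_bound_of_hasCompactSupport hf.continuous hc
  obtain ⟨CG, hCG0, hCG⟩ := exists_bound_angleGenerator (κ := κ) (ρ := ρ) hf hc hsupp
  refine ⟨Cf + Cf + CG * |t - s|, by positivity, fun x ↦ ?_⟩
  have hI : |∫ u in s..t, angleGenerator κ ρ f (x u)| ≤ CG * |t - s| := by
    rw [← Real.norm_eq_abs]
    exact intervalIntegral.norm_integral_le_of_norm_le_const fun u _ ↦ by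
      rw [Real.norm_eq_abs]; exact hCG (x u)
  unfold angleIncrement
  calc |f (x t) - f (x s) - ∫ u in s..t, angleGenerator κ ρ f (x u)|
      ≤ |f (x t) - f (x s)| + |∫ u in s..t, angleGenerator κ ρ f (x u)| := abs_sub _ _
    _ ≤ (|f (x t)| + |f (x s)|) + CG * |t - s| := add_le_add (abs_sub _ _) hI
    _ ≤ (Cf + Cf) + CG * |t - s| := by gcongr <;> apply hCf

/-- **The increment functional is integrable under every finite measure on path space.**
[folklore] -/
theorem integrable_angleIncrement (hf : ContDiff ℝ 2 f) (hc : HasCompactSupport f)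
    (hsupp : tsupport f ⊆ Ioo 0 (2 * π)) (s t : ℝ) (P : Measure C(ℝ, ℝ)) [IsFiniteMeasure P] :
    Integrable (angleIncrement κ ρ f s t) P := by
  obtain ⟨C, -, hC⟩ := exists_bound_angleIncrement (κ := κ) (ρ := ρ) hf hc hsupp s t
  exact Integrable.mono' (integrable_const C) (measurable_angleIncrement hf hsupp s t).aestronglyMeasurable
    (Eventually.of_forall fun x ↦ by simpa [Real.norm_eq_abs] using hC x)

end Increment

/-! ### Time scaling of paths -/

section TimeScale

/-- **Time scaling** `x ↦ x(c ·)` on two-sided paths. [folklore] -/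
def timeScale (c : ℝ) (x : C(ℝ, ℝ)) : C(ℝ, ℝ) :=
  x.comp ⟨fun t ↦ c * t, continuous_const.mul continuous_id⟩

/-- Value of a time-scaled path. [folklore] -/
@[simp] theorem timeScale_apply (c : ℝ) (x : C(ℝ, ℝ)) (t : ℝ) : timeScale c x t = x (c * t) := rfl

/-- Scaling by `1` is the identity. [folklore] -/
@[simp] theorem timeScale_one (x : C(ℝ, ℝ)) : timeScale 1 x = x := by
  ext t; simp

/-- Scalings compose multiplicatively. [folklore] -/
theorem timeScale_timeScale (c c' : ℝ) (x : C(ℝ, ℝ)) :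
    timeScale c (timeScale c' x) = timeScale (c' * c) x := by
  ext t; simp [mul_assoc]

/-- `timeScale c⁻¹` undoes `timeScale c` (`c ≠ 0`). [folklore] -/
theorem timeScale_inv_timeScale {c : ℝ} (hc : c ≠ 0) (x : C(ℝ, ℝ)) :
    timeScale c⁻¹ (timeScale c x) = x := by
  rw [timeScale_timeScale, mul_inv_cancel₀ hc, timeScale_one]

/-- The time scaling is continuous on `C(ℝ, ℝ)`. [folklore] -/
theorem continuous_timeScale (c : ℝ) : Continuous (timeScale c) :=
  ContinuousMap.continuous_precomp _

/-- The time scaling is Borel measurable. [folklore] -/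
theorem measurable_timeScale (c : ℝ) : Measurable (timeScale c) :=
  (continuous_timeScale c).measurable

/-- Time shifts and scalings: `θₛ ∘ S_c = S_c ∘ θ_{cs}`. [folklore] -/
theorem timeShift_timeScale (s c : ℝ) (x : C(ℝ, ℝ)) :
    timeShift s (timeScale c x) = timeScale c (timeShift (c * s) x) := by
  ext t; simp [mul_add]

/-- Pushing forward by `S_c` and then by `S_{c⁻¹}` is the identity (`c ≠ 0`). [folklore] -/
theorem map_timeScale_map_timeScale_inv {c : ℝ} (hc : c ≠ 0) (P : Measure C(ℝ, ℝ)) :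
    (P.map (timeScale c)).map (timeScale c⁻¹) = P := by
  rw [Measure.map_map (measurable_timeScale _) (measurable_timeScale _)]
  have : timeScale c⁻¹ ∘ timeScale c = id := funext fun x ↦ timeScale_inv_timeScale hc x
  rw [this, Measure.map_id]

/-- **`S_c` is `ℱ_{cs} / ℱ_s`-measurable** (`c ≥ 0`): the coordinates of `x(c ·)` up to time `s`
are coordinates of `x` up to time `cs`. [folklore] -/
theorem measurable_timeScale_angleFiltration {c : ℝ} (hc : 0 ≤ c) (s : ℝ) :
    Measurable[angleFiltration (c * s), angleFiltration s] (timeScale c) := by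
  rw [measurable_iff_comap_le]
  change MeasurableSpace.comap (timeScale c)
      (⨆ j ≤ s, MeasurableSpace.comap (fun x : C(ℝ, ℝ) ↦ x j) inferInstance) ≤
    ⨆ j ≤ c * s, MeasurableSpace.comap (fun x : C(ℝ, ℝ) ↦ x j) inferInstance
  simp only [MeasurableSpace.comap_iSup, MeasurableSpace.comap_comp]
  refine iSup₂_le fun j hj ↦ ?_
  have hcomp : (fun x : C(ℝ, ℝ) ↦ x j) ∘ timeScale c = fun x ↦ x (c * j) := by
    ext x; simp
  rw [hcomp]
  exact le_iSup₂ (f := fun (j : ℝ) (_ : j ≤ c * s) ↦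
    MeasurableSpace.comap (fun x : C(ℝ, ℝ) ↦ x j) inferInstance) (c * j)
    (mul_le_mul_of_nonneg_left hj hc)

/-- **The increment functional under time scaling** (`c > 0`):
`N^{f; cκ, c(ρ+2)-2}_{s,t}(x(c ·)) = N^{f; κ, ρ}_{cs, ct}(x)` (substitution `v = cu` in the time
integral, `L_{cκ, c(ρ+2)-2} = c L_{κ,ρ}`). [folklore] -/
theorem angleIncrement_timeScale {c : ℝ≥0} (hc : 0 < c) (κ : ℝ≥0) (ρ : ℝ) (f : ℝ → ℝ) (s t : ℝ)
    (x : C(ℝ, ℝ)) :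
    angleIncrement (c * κ) (c * (ρ + 2) - 2) f s t (timeScale c x) =
      angleIncrement κ ρ f (c * s) (c * t) x := by
  have hc0 : ((c : ℝ≥0) : ℝ) ≠ 0 := by exact_mod_cast hc.ne'
  unfold angleIncrement
  simp only [timeScale_apply, angleGenerator_scale]
  rw [intervalIntegral.integral_const_mul,
    intervalIntegral.integral_comp_mul_left (fun v ↦ angleGenerator κ ρ f (x v)) hc0, smul_eq_mul,
    ← mul_assoc, mul_inv_cancel₀ hc0, one_mul]

/-- The set of two-sided paths staying in `(0, 2π)` at all times is Borel measurable (a countable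
intersection, over the compact windows `[-N, N]`, of open sets of the compact-open topology).
[folklore] -/
theorem measurableSet_forall_mem_Ioo :
    MeasurableSet {x : C(ℝ, ℝ) | ∀ t : ℝ, x t ∈ Ioo 0 (2 * π)} := by
  have heq : {x : C(ℝ, ℝ) | ∀ t : ℝ, x t ∈ Ioo 0 (2 * π)} =
      ⋂ N : ℕ, {x : C(ℝ, ℝ) | MapsTo x (Icc (-(N : ℝ)) N) (Ioo 0 (2 * π))} := by
    ext x
    simp only [mem_setOf_eq, mem_iInter]
    constructor
    · exact fun h N u _ ↦ h u
    · intro h u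
      obtain ⟨N, hN⟩ := exists_nat_ge |u|
      exact h N ⟨by linarith [neg_abs_le u], (le_abs_self u).trans hN⟩
  rw [heq]
  exact MeasurableSet.iInter fun N ↦
    (ContinuousMap.isOpen_setOf_mapsTo isCompact_Icc isOpen_Ioo).measurableSet

variable {κ : ℝ≥0} {ρ : ℝ} {P : Measure C(ℝ, ℝ)}

/-- **Time scaling transports stationary angle laws**: if `P` is a stationary SLE_κ(ρ) angle law
and `c > 0`, then the law of `t ↦ X_{ct}` is a stationary angle law with parameters
`(cκ, c(ρ+2) - 2)` (same Bessel dimension `1 + 2(ρ+2)/κ`). Miller–Sheffield (2017), §2.1.2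
(the SDE (2.5) under the time change `t ↦ ct`). [cite: MillerSheffield2013, §2.1.2 eq. (2.5)] -/
theorem IsStationaryAngleLaw.map_timeScale (h : IsStationaryAngleLaw κ ρ P) {c : ℝ≥0}
    (hc : 0 < c) : IsStationaryAngleLaw (c * κ) (c * (ρ + 2) - 2) (P.map (timeScale c)) := by
  obtain ⟨hP, hpath, hshift, hmart⟩ := h
  have hcr : (0 : ℝ) < c := by exact_mod_cast hc
  have hmT := measurable_timeScale (c : ℝ)
  refine ⟨Measure.isProbabilityMeasure_map hmT.aemeasurable, ?_, fun s ↦ ?_, fun f hf hfc hsupp s t hst ↦ ?_⟩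
  · exact (ae_map_iff hmT.aemeasurable measurableSet_forall_mem_Ioo).2
      (hpath.mono fun x hx t ↦ by simpa using hx (c * t))
  · rw [Measure.map_map (measurable_timeShift s) hmT]
    have hcomp : timeShift s ∘ timeScale (c : ℝ) = timeScale (c : ℝ) ∘ timeShift (c * s) :=
      funext fun x ↦ timeShift_timeScale s c x
    rw [hcomp, ← Measure.map_map hmT (measurable_timeShift _), hshift]
  · haveI : IsProbabilityMeasure (P.map (timeScale (c : ℝ))) := Measure.isProbabilityMeasure_map hmT.aemeasurable
    have hcst : (c : ℝ) * s ≤ c * t := mul_le_mul_of_nonneg_left hst hcr.le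
    obtain ⟨hint, hce⟩ := hmart f hf hfc hsupp (c * s) (c * t) hcst
    have hcompf : angleIncrement (c * κ) (c * (ρ + 2) - 2) f s t ∘ timeScale (c : ℝ) =
        angleIncrement κ ρ f (c * s) (c * t) := funext (angleIncrement_timeScale hc κ ρ f s t)
    have hmN := measurable_angleIncrement (κ := c * κ) (ρ := c * (ρ + 2) - 2) hf hsupp s t
    have hint' : Integrable (angleIncrement (c * κ) (c * (ρ + 2) - 2) f s t) (P.map (timeScale (c : ℝ))) := by
      rw [integrable_map_measure hmN.aestronglyMeasurable hmT.aemeasurable, hcompf]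
      exact hint
    refine ⟨hint', ?_⟩
    rw [condExp_ae_eq_zero_iff_forall_setIntegral_eq_zero (angleFiltration.le s) hint']
    intro A hA
    rw [setIntegral_map (angleFiltration.le s A hA) hmN.aestronglyMeasurable hmT.aemeasurable]
    have hA' : MeasurableSet[angleFiltration (c * s)] (timeScale (c : ℝ) ⁻¹' A) :=
      measurable_timeScale_angleFiltration hcr.le s hA
    have h0 := (condExp_ae_eq_zero_iff_forall_setIntegral_eq_zero (angleFiltration.le (c * s)) hint).1
      hce _ hA'
    simpa only [Function.comp_def] using (congrArg (fun g : C(ℝ, ℝ) → ℝ ↦ ∫ x in timeScale (c : ℝ) ⁻¹' A, g x ∂P)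
      hcompf).trans h0

/-- **Time scaling is an equivalence of stationary angle laws** (`c > 0`). [folklore] -/
theorem isStationaryAngleLaw_map_timeScale_iff {c : ℝ≥0} (hc : 0 < c) :
    IsStationaryAngleLaw (c * κ) (c * (ρ + 2) - 2) (P.map (timeScale c)) ↔
      IsStationaryAngleLaw κ ρ P := by
  refine ⟨fun h ↦ ?_, fun h ↦ h.map_timeScale hc⟩
  have hc0 : (c : ℝ≥0) ≠ 0 := hc.ne'
  have h' := h.map_timeScale (c := c⁻¹) (inv_pos.2 hc)
  rw [NNReal.coe_inv, map_timeScale_map_timeScale_inv (by exact_mod_cast hc0 : ((c : ℝ≥0) : ℝ) ≠ 0)] at h'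
  convert h' using 2
  · rw [← mul_assoc, inv_mul_cancel₀ hc0, one_mul]
  · have : ((c : ℝ≥0) : ℝ) ≠ 0 := by exact_mod_cast hc0
    field_simp
    ring

/-- **Reduction of `IsStationaryAngleLaw.exists_unique` to the case `ρ = 0`, `0 < κ ≤ 4`**: for
`κ ≤ 2(ρ+2)` the scaling `c = 2/(ρ+2)` maps SLE_κ(ρ) angle laws bijectively onto SLE_{κ'}(0)
angle laws with `κ' = 2κ/(ρ+2) ≤ 4` — the stationary laws of the radial Bessel process
`dY = cot(Y/2) dt + √κ' dB`. [cite: MillerSheffield2013, Prop. 2.1] -/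
theorem IsStationaryAngleLaw.exists_unique_of_rho_zero
    (h0 : ∀ κ' : ℝ≥0, 0 < κ' → κ' ≤ 4 →
      ∃! P : Measure C(ℝ, ℝ), IsStationaryAngleLaw κ' 0 P) :
    IsStationaryAngleLaw.exists_unique := by
  intro κ ρ hκ hκρ
  have hκr : (0 : ℝ) < κ := by exact_mod_cast hκ
  have hρ : 0 < ρ + 2 := by linarith
  -- the scaling factor `c = 2/(ρ+2)`
  set c : ℝ≥0 := ⟨2 / (ρ + 2), by positivity⟩ with hcdef
  have hcr : ((c : ℝ≥0) : ℝ) = 2 / (ρ + 2) := rfl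
  have hc : 0 < c := by
    rw [← NNReal.coe_pos, hcr]; positivity
  have hρ' : (c : ℝ) * (ρ + 2) - 2 = 0 := by rw [hcr]; field_simp; ring
  have hκ' : 0 < c * κ := mul_pos hc hκ
  have hκ'4 : c * κ ≤ 4 := by
    rw [← NNReal.coe_le_coe, NNReal.coe_mul, hcr]
    rw [div_mul_eq_mul_div, div_le_iff₀ hρ]
    push_cast
    linarith
  obtain ⟨Q, hQ, hQu⟩ := h0 (c * κ) hκ' hκ'4
  have hc0 : ((c : ℝ≥0) : ℝ) ≠ 0 := by exact_mod_cast hc.ne'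
  have hiff : ∀ P : Measure C(ℝ, ℝ),
      IsStationaryAngleLaw κ ρ P ↔ IsStationaryAngleLaw (c * κ) 0 (P.map (timeScale c)) := by
    intro P
    rw [← isStationaryAngleLaw_map_timeScale_iff (κ := κ) (ρ := ρ) (P := P) hc, hρ']
  refine ⟨Q.map (timeScale (c : ℝ)⁻¹), (hiff _).2 ?_, fun P hP ↦ ?_⟩
  · have hback : (Q.map (timeScale (c : ℝ)⁻¹)).map (timeScale c) = Q := by
      have h := map_timeScale_map_timeScale_inv (inv_ne_zero hc0) Q
      rwa [inv_inv] at h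
    rw [hback]
    exact hQ
  · have h1 : P.map (timeScale c) = Q := hQu _ ((hiff P).1 hP)
    rw [← h1, map_timeScale_map_timeScale_inv hc0]

end TimeScale

end Literature.Probability.RandomPlanarGeometry
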